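import Literature.Barriers.NavierStokesRegularity.SchefferSwitchedIntegrability
import HarnessLib

/-!
# Scheffer's switched field: smooth compactly supported slices and the singular point

Barrier-catalogue support file for `NavierStokesRegularity` (D-0021), part of the discharge of
`IsNSIBlock.switching` / `NSISwitching` (Scheffer 1985, Lemma 2.3; Ożański 2017, §2). For the
glued field `𝔲 = Scheffer.glue T τ z u` of a classical NSI block:

* `contDiff_glue_slice`, `tsupport_glue_slice_subset` — every slice `𝔲(t)`, `t ≥ 0`, is `C^∞`
  with support in `G` (Ożański 2017, §2: "by construction `𝔲` is divergence-free, smooth in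
  space, its support in space is contained in `G`");
* `not_isRegularPoint_glue` — **`(T₀, x₀)` is a singular point**: `𝔲` is not essentially
  bounded on any centred parabolic cylinder `Q*_r(T₀, x₀)` (Ożański 2017, §2: "`𝔲` is unbounded
  in every neighbourhood of `(x₀, T₀)`"; Scheffer 1985, (2.30): "not essentially bounded on any
  neighborhood of the point `((1-τ)⁻¹a, (1-τ²)⁻¹T)`"). Proof: `u(0, x*) ≠ 0` for some `x*`; the
  `j`-th piece takes the value `τ^{-j}u(0, x*)` at `(t_j, Γʲ(x*))`, where `t_j ↑ T₀` and
  `Γʲ(x*) → x₀`; by continuity of the piece on its closed strip, `|𝔲| > M + 1` on an open set of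
  positive measure inside the cylinder, contradicting an essential bound `M`.

## References

* W. S. Ożański, arXiv:1709.00602 (2017), §2 pp. 6–7. [`Ozanski2017NSISingular`]
* V. Scheffer, Comm. Math. Phys. 101 (1985), Lemma 2.3 (2.30) and the end of its proof (p. 57).
  [`Scheffer1985`]
-/

noncomputable section

open MeasureTheory Set Function Filter Topology TopologicalSpace Metric Module
open scoped ENNReal InnerProductSpace RealInnerProductSpace ContDiff Laplacian

namespace Literature.Barriers.NavierStokesRegularity

namespace IsNSIBlock

open Scheffer Literature.Analysis.FluidPDE

variable {T ν₀ τ : ℝ} {z : EuclideanSpace ℝ (Fin 3)} {G : Set (EuclideanSpace ℝ (Fin 3))}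
  {u : ℝ → EuclideanSpace ℝ (Fin 3) → EuclideanSpace ℝ (Fin 3)}

/-! ### The slices of the glued field -/

/-- **Every slice `𝔲(t)` of the glued field is `C^∞`** (a rescaled slice of `u`, or zero).
[cite: Ozanski2017NSISingular, §2 p. 6] -/
theorem contDiff_glue_slice (h : IsNSIBlock T ν₀ τ z G u) (t : ℝ) : ContDiff ℝ ∞ (glue T τ z u t) := by
  by_cases ht : t ∈ Ico 0 (blowupTime T τ)
  · obtain ⟨j, hj⟩ := exists_mem_Ico_switchTime h.τ_pos h.τ_lt_one ht.1 ht.2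
    rw [glue_eq_piece h.T_pos h.τ_pos z u hj]
    exact h.contDiff_piece_slice (Ico_subset_Icc_self hj)
  · rw [h.glue_eq_zero_of_notMem ht]
    exact contDiff_const

/-- **Every slice `𝔲(t)` of the glued field is supported in `G`** (`supp u^{(j)}(t) = Γʲ(G) ⊆ G`).
[cite: Ozanski2017NSISingular, §2 (2.5)] -/
theorem tsupport_glue_slice_subset (h : IsNSIBlock T ν₀ τ z G u) (t : ℝ) :
    tsupport (glue T τ z u t) ⊆ G := by
  by_cases ht : t ∈ Ico 0 (blowupTime T τ)
  · obtain ⟨j, hj⟩ := exists_mem_Ico_switchTime h.τ_pos h.τ_lt_one ht.1 ht.2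
    rw [glue_eq_piece h.T_pos h.τ_pos z u hj]
    exact h.tsupport_piece_slice_subset (Ico_subset_Icc_self hj)
  · rw [h.glue_eq_zero_of_notMem ht]
    intro x hx
    rw [tsupport, Function.support_zero, closure_empty] at hx
    exact absurd hx (notMem_empty x)

/-! ### The singular point -/

/-- The iterates `Γʲ(x*)` of any point converge to the centre `x₀ = z/(1-τ)`. [cite: Ozanski2017NSISingular, §2 p. 6] -/
theorem tendsto_similarity_iterate (h : IsNSIBlock T ν₀ τ z G u) (x : EuclideanSpace ℝ (Fin 3)) :
    Tendsto (fun j : ℕ => (fun y : EuclideanSpace ℝ (Fin 3) => τ • y + z)^[j] x) atTop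
      (𝓝 (blowupPoint τ z)) := by
  have hpow : Tendsto (fun j : ℕ => τ ^ j) atTop (𝓝 0) :=
    tendsto_pow_atTop_nhds_zero_of_lt_one h.τ_pos.le h.τ_lt_one
  have h1 : Tendsto (fun j : ℕ => (1 - τ)⁻¹ • z + τ ^ j • (x - (1 - τ)⁻¹ • z)) atTop
      (𝓝 ((1 - τ)⁻¹ • z + (0 : ℝ) • (x - (1 - τ)⁻¹ • z))) :=
    (hpow.smul_const (x - (1 - τ)⁻¹ • z)).const_add _
  rw [zero_smul, add_zero] at h1
  refine (h1.congr fun j => ?_).trans (by rfl)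
  exact (similarity_iterate_eq h.τ_lt_one.ne z x j).symm

/-- **The blow-up point is singular** (Ożański 2017, §2: "`𝔲` is unbounded in every
neighbourhood of `(x₀, T₀)`"; Scheffer 1985, Lemma 2.3 (2.30): "`u` is not essentially bounded
on any neighborhood of the point `((1-τ)⁻¹a, (1-τ²)⁻¹T)`"): the glued field is not essentially
bounded on any centred parabolic cylinder about `(T₀, x₀) = (T/(1-τ²), z/(1-τ))`, i.e.
`(T₀, x₀)` is not a regular point in the sense of the accepted `IsRegularPoint`. With `x*` such
that `u(0, x*) ≠ 0`, the `j`-th piece equals `τ^{-j}u(0,x*)` at `(t_j, Γʲ(x*)) → (T₀, x₀)`, and by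
continuity `|𝔲| ≥ M + 1` on an open set of positive measure inside the cylinder.
[cite: Ozanski2017NSISingular, §2 pp. 6–7] [cite: Scheffer1985, Lemma 2.3 (2.30)] -/
theorem not_isRegularPoint_glue (h : IsNSIBlock T ν₀ τ z G u) :
    ¬ IsRegularPoint (glue T τ z u) (blowupTime T τ, blowupPoint τ z) := by
  rintro ⟨r, hr, hfin⟩
  -- the essential bound `M`
  set μ : Measure (ℝ × EuclideanSpace ℝ (Fin 3)) := volume.restrict
    (parabolicCylinderCentered r ((blowupTime T τ, blowupPoint τ z) : ℝ × EuclideanSpace ℝ (Fin 3)))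
    with hμ
  set M : ℝ≥0∞ := eLpNorm (uncurry (glue T τ z u)) ∞ μ with hM
  have hMfin : M < ⊤ := hfin
  have hae : ∀ᵐ q ∂μ, ‖uncurry (glue T τ z u) q‖ₑ ≤ M := by
    rw [hM, eLpNorm_exponent_top]
    exact ae_le_eLpNormEssSup
  set K : ℝ := M.toReal + 1 with hK
  have hKM : M < ENNReal.ofReal K := by
    rw [hK]
    calc M = ENNReal.ofReal M.toReal := (ENNReal.ofReal_toReal hMfin.ne).symm
      _ < ENNReal.ofReal (M.toReal + 1) :=
        ENNReal.ofReal_lt_ofReal_iff'.2 ⟨by linarith, by linarith [ENNReal.toReal_nonneg (a := M)]⟩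
  -- a point where `u(0)` does not vanish
  obtain ⟨xs, hxs⟩ := h.nontrivial
  have hpos : 0 < ‖u 0 xs‖ := norm_pos_iff.2 hxs
  -- choice of the piece index
  have ev1 : ∀ᶠ j : ℕ in atTop, blowupTime T τ - r ^ 2 < switchTime T τ j :=
    (tendsto_switchTime h.τ_pos.le h.τ_lt_one).eventually (lt_mem_nhds (by nlinarith))
  have ev2 : ∀ᶠ j : ℕ in atTop,
      dist ((fun y : EuclideanSpace ℝ (Fin 3) => τ • y + z)^[j] xs) (blowupPoint τ z) < r / 2 :=
    Metric.tendsto_nhds.1 (h.tendsto_similarity_iterate xs) (r / 2) (by positivity)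
  have ev3 : ∀ᶠ j : ℕ in atTop, K < (τ⁻¹) ^ j * ‖u 0 xs‖ :=
    ((tendsto_pow_atTop_atTop_of_one_lt ((one_lt_inv₀ h.τ_pos).2 h.τ_lt_one)).atTop_mul_const
      hpos).eventually_gt_atTop K
  obtain ⟨j, hj1, hj2, hj3⟩ := (ev1.and (ev2.and ev3)).exists
  -- the point `(t_j, Γʲ(x*))` and the value of the `j`-th piece there
  set tj : ℝ := switchTime T τ j with htj
  set xj : EuclideanSpace ℝ (Fin 3) := (fun y : EuclideanSpace ℝ (Fin 3) => τ • y + z)^[j] xs with hxj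
  have hlt : tj < switchTime T τ (j + 1) := strictMono_switchTime h.T_pos h.τ_pos (Nat.lt_succ_self j)
  have hval : piece T τ z u j tj xj = (τ⁻¹) ^ j • u 0 xs := by
    rw [hxj, piece_apply_similarity_iterate h.τ_pos.ne' h.τ_lt_one.ne, htj, sub_self, mul_zero]
  have hnorm : K < ‖uncurry (piece T τ z u j) (tj, xj)‖ := by
    simp only [uncurry_apply_pair, hval, norm_smul, Real.norm_of_nonneg (h.inv_tau_pow_pos j).le]
    exact hj3
  -- continuity of the piece on its closed strip gives a neighbourhood where `|u^{(j)}| > K`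
  have hcont := h.continuousOn_uncurry_piece j
  have hmem : ((tj, xj) : ℝ × EuclideanSpace ℝ (Fin 3)) ∈ Icc tj (switchTime T τ (j + 1)) ×ˢ univ :=
    ⟨⟨le_rfl, hlt.le⟩, mem_univ _⟩
  have hpre : (fun q => ‖uncurry (piece T τ z u j) q‖) ⁻¹' Ioi K ∈
      𝓝[Icc tj (switchTime T τ (j + 1)) ×ˢ univ] ((tj, xj) : ℝ × EuclideanSpace ℝ (Fin 3)) :=
    ((hcont (tj, xj) hmem).norm).preimage_mem_nhdsWithin (Ioi_mem_nhds hnorm)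
  obtain ⟨δ, hδ, hball⟩ := Metric.mem_nhdsWithin_iff.1 hpre
  -- the small open box `U` inside the strip, the neighbourhood and the cylinder
  set δ' : ℝ := min δ (min (r / 2) (switchTime T τ (j + 1) - tj)) with hδ'
  have hδ'pos : 0 < δ' := lt_min hδ (lt_min (by positivity) (sub_pos.2 hlt))
  have hδ'δ : δ' ≤ δ := min_le_left _ _
  have hδ'r : δ' ≤ r / 2 := (min_le_right _ _).trans (min_le_left _ _)
  have hδ't : δ' ≤ switchTime T τ (j + 1) - tj := (min_le_right _ _).trans (min_le_right _ _)
  set U : Set (ℝ × EuclideanSpace ℝ (Fin 3)) := Ioo tj (tj + δ') ×ˢ ball xj δ' with hU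
  have hUmeas : MeasurableSet U := measurableSet_Ioo.prod measurableSet_ball
  -- `U` lies in the cylinder
  have hUQ : U ⊆ parabolicCylinderCentered r ((blowupTime T τ, blowupPoint τ z) : ℝ × EuclideanSpace ℝ (Fin 3)) := by
    rintro ⟨s, x⟩ ⟨hs, hx⟩
    rw [mem_parabolicCylinderCentered]
    refine ⟨⟨by linarith [hs.1], ?_⟩, ?_⟩
    · have := switchTime_lt_blowupTime h.T_pos h.τ_pos h.τ_lt_one (j + 1)
      have hr2 : 0 < r ^ 2 := by positivity
      simp only
      linarith [hs.2]
    · calc dist x (blowupPoint τ z) ≤ dist x xj + dist xj (blowupPoint τ z) := dist_triangle _ _ _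
        _ < δ' + r / 2 := add_lt_add (mem_ball.1 hx) hj2
        _ ≤ r := by linarith
  -- on `U` the glued field is the `j`-th piece and exceeds `K`
  have hUK : ∀ q ∈ U, K < ‖uncurry (glue T τ z u) q‖ := by
    rintro ⟨s, x⟩ ⟨hs, hx⟩
    have hsI : s ∈ Ico tj (switchTime T τ (j + 1)) := ⟨hs.1.le, by linarith [hs.2]⟩
    have hq : ((s, x) : ℝ × EuclideanSpace ℝ (Fin 3)) ∈ ball ((tj, xj) : ℝ × EuclideanSpace ℝ (Fin 3)) δ ∩
        (Icc tj (switchTime T τ (j + 1)) ×ˢ univ) := by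
      refine ⟨?_, ⟨Ico_subset_Icc_self hsI, mem_univ _⟩⟩
      rw [mem_ball, Prod.dist_eq, max_lt_iff]
      refine ⟨?_, (mem_ball.1 hx).trans_le hδ'δ⟩
      rw [Real.dist_eq, abs_of_pos (sub_pos.2 hs.1)]
      linarith [hs.2]
    have := hball hq
    simp only [mem_preimage, mem_Ioi, uncurry_apply_pair] at this
    simpa only [uncurry_apply_pair, glue_eq_piece h.T_pos h.τ_pos z u hsI] using this
  -- `U` has positive measure ...
  have hUpos : 0 < μ U := by
    rw [hμ, Measure.restrict_apply hUmeas, inter_eq_left.2 hUQ, hU, Measure.volume_eq_prod,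
      Measure.prod_prod, Real.volume_Ioo, add_sub_cancel_left]
    exact ENNReal.mul_pos (ENNReal.ofReal_pos.2 hδ'pos).ne' (measure_ball_pos volume xj hδ'pos).ne'
  -- ... but the essential bound forces it to be null
  have hU0 : μ U = 0 := by
    rw [ae_iff] at hae
    refine measure_mono_null (fun q hq => ?_) hae
    simp only [mem_setOf_eq, not_le]
    calc M < ENNReal.ofReal K := hKM
      _ ≤ ENNReal.ofReal ‖uncurry (glue T τ z u) q‖ := ENNReal.ofReal_le_ofReal (hUK q hq).le
      _ = ‖uncurry (glue T τ z u) q‖ₑ := ofReal_norm _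
  exact absurd hU0 hUpos.ne'

end IsNSIBlock

end Literature.Barriers.NavierStokesRegularity

end
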